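import Summits.MatrixMultiplication.OmegaCensus.SmallFormats.MatMul22nZKKIRowTypes
import Summits.MatrixMultiplication.OmegaCensus.SmallFormats.MatMul22nAllOnesColTypes
import HarnessLib

/-!
# ω-census family (a): the column-side twins of the `(Z,K,K,I)` row lemmas over `𝔽₃` — empty block zero, single-cell OUTPUT shapes, distinct null points

Cell `pub-omega` (unit `pub-omega-tensor`, gen 42), topic `Summits/MatrixMultiplication/OmegaCensus` (sub-folder
`SmallFormats`). Framing (verbatim): lottery ticket; floor = certified bounds/negative ranges. HONEST FRAMING: the transpose-dual
(`exists_transposeDual'`: `(f, g, w) ↦ (f∘ᵀ, ⟨w,·⟩, G)`, the device of `AllOnesColTypes`) of `MatMul22nZKKIRowTypes` (this seat): for a COLUMN of the P2-type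
grid with pattern `(Z,K,K,I)` — cheap plane `span(b)` on the output side, four terms with linearly independent OUTPUTS —
* `ZKKICol.empty_block_eq_zero`: all four terms outside a row plane `R` (cheap output data `c`) ⇒ the Gram block `(b l ⬝ᵥ c m)` vanishes;
* `ZKKICol.single_shape`: a single term cheap for the double cell's ROW `D` (invertible block) and for the other single's row `S'` (non-zero singular block, left
  null representative `rep r`) has output coefficient matrix `A q l = e · rep D q · rep r l` (both output rows on the kill covector `∑_l rep r l • b l`);
* `ZKKICol.null_reps_ne`: the two singles of the column have different null points.
Second brick of the kernel route to «K4 = `Cover827.REP827 3` is not an X-marginal» (HOME/pub-omega-tensor-g42/INVTEST-g42.md §6 (A)). Nothing on `ω`.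
-/

namespace Summit.MatrixMultiplication.OmegaCensus.SmallFormats

open Finset Module Matrix
open Literature.Computability.AlgebraicComplexity
open Summit.MatrixMultiplication.OmegaCensus.RankOnePlaneCapGeneral

namespace ZKKICol

variable {n : ℕ} {ι : Type*} [Fintype ι]

/-- **The EMPTY cell's Gram block vanishes (column side).** Four terms with linearly independent outputs whose output rows lie in `span(b)`, all cheap
for a row plane `R` with cheap output data `c` (`∑_i c m i · (ν ᵥ* W_t) i = 0` off `R`, `ν ≠ 0`): `b l ⬝ᵥ c m = 0` for all `l, m`. -/
theorem empty_block_eq_zero (β : BilinComp (mulBilin (ZMod 3) 2 2 n) ι) (ν : Fin 2 → ZMod 3) (hν : ν ≠ 0) (R : Finset ι)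
    (c : Fin 2 → (Fin n → ZMod 3)) (hcch : ∀ t, t ∉ R → ∀ m, ∑ i, c m i * (Matrix.vecMul ν (β.w t)) i = 0) (b : Fin 2 → (Fin n → ZMod 3))
    (t : Fin 4 → ι) (htR : ∀ i, t i ∉ R)
    (hrows : ∀ i (κ : Fin 2), ∃ a : Fin 2 → ZMod 3, β.w (t i) κ = ∑ m, a m • b m)
    (hind : LinearIndependent (ZMod 3) (fun i => β.w (t i))) :
    ∀ l m, b l ⬝ᵥ c m = 0 := by
  classical
  obtain ⟨β', -, hg, hw⟩ := exists_transposeDual' β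
  have hrows' : ∀ s κ, (fun jj => β'.g s (Matrix.single κ jj (1 : ZMod 3))) = β.w s κ := by
    intro s κ; funext jj; rw [hg, CheapSpans.sum_w_mul_single]
  have hcr' : ∀ i (κ : Fin 2), ∃ a : Fin 2 → ZMod 3, (fun jj => β'.g (t i) (Matrix.single κ jj (1 : ZMod 3))) = ∑ m, a m • b m := by
    intro i κ; rw [hrows']; exact hrows i κ
  have hbch' : ∀ t', t' ∉ R → ∀ m, β'.g t' (Matrix.vecMulVec ν (c m)) = 0 := by
    intro t' ht' m
    rw [hg, RowSubcomp.pairing_eq]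
    exact hcch t' ht' m
  have hind' : LinearIndependent (ZMod 3) (fun i => β'.g (t i)) := by
    obtain ⟨Ψ, hΨ, hker⟩ := AllOnesColTypes.exists_pairingMap (k := ZMod 3) (n := n)
    have hcomp : (fun i => β'.g (t i)) = Ψ ∘ (fun i => β.w (t i)) := by
      funext i; ext Y'; rw [hg]; exact (hΨ _ _).symm
    rw [hcomp]
    exact hind.map' Ψ hker
  exact ZKKIRow.empty_block_eq_zero β' ν hν R c hbch' b t htR hcr' hind'

/-- **Shape of a single cell in a `(Z,K,K,I)` column (output side).** A term `t` with output rows `β.w t κ = ∑_l A κ l • b l`, cheap for the double cell's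
row `D` (block `(b l ⬝ᵥ cD m)` invertible) and for the other single's row `S'` (block `(b l ⬝ᵥ cS m)` non-zero, singular, left null representative
`rep r`), `D ≠ S'`: `A q l = e · rep D q · rep r l` for one scalar `e`. -/
theorem single_shape (β : BilinComp (mulBilin (ZMod 3) 2 2 n) ι) (b : Fin 2 → (Fin n → ZMod 3)) (t : ι)
    (A : Matrix (Fin 2) (Fin 2) (ZMod 3)) (hA : ∀ κ : Fin 2, β.w t κ = ∑ l, A κ l • b l)
    (Dr S' : Fin 4) (hDS : Dr ≠ S') (RD RS : Finset ι) (cD cS : Fin 2 → (Fin n → ZMod 3)) (htD : t ∉ RD) (htS : t ∉ RS)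
    (hDch : ∀ t', t' ∉ RD → ∀ m, ∑ i, cD m i * (Matrix.vecMul (![-((![![1, 0], ![0, 1], ![1, 1], ![1, 2]] : Fin 4 → Fin 2 → ZMod 3) Dr 1), (![![1, 0], ![0, 1], ![1, 1], ![1, 2]] : Fin 4 → Fin 2 → ZMod 3) Dr 0] : Fin 2 → ZMod 3) (β.w t')) i = 0)
    (hSch : ∀ t', t' ∉ RS → ∀ m, ∑ i, cS m i * (Matrix.vecMul (![-((![![1, 0], ![0, 1], ![1, 1], ![1, 2]] : Fin 4 → Fin 2 → ZMod 3) S' 1), (![![1, 0], ![0, 1], ![1, 1], ![1, 2]] : Fin 4 → Fin 2 → ZMod 3) S' 0] : Fin 2 → ZMod 3) (β.w t')) i = 0)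
    (hDdet : (Matrix.of fun l m => b l ⬝ᵥ cD m : Matrix (Fin 2) (Fin 2) (ZMod 3)).det ≠ 0)
    (hSnz : (Matrix.of fun l m => b l ⬝ᵥ cS m : Matrix (Fin 2) (Fin 2) (ZMod 3)) ≠ 0) (r : Fin 4)
    (hSr : Matrix.vecMul ((![![1, 0], ![0, 1], ![1, 1], ![1, 2]] : Fin 4 → Fin 2 → ZMod 3) r) (Matrix.of fun l m => b l ⬝ᵥ cS m) = 0) :
    ∃ e : ZMod 3, ∀ q l, A q l = e * (![![1, 0], ![0, 1], ![1, 1], ![1, 2]] : Fin 4 → Fin 2 → ZMod 3) Dr q * (![![1, 0], ![0, 1], ![1, 1], ![1, 2]] : Fin 4 → Fin 2 → ZMod 3) r l := by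
  classical
  obtain ⟨β', -, hg, hw⟩ := exists_transposeDual' β
  have hrows' : ∀ κ, (fun jj => β'.g t (Matrix.single κ jj (1 : ZMod 3))) = β.w t κ := by
    intro κ; funext jj; rw [hg, CheapSpans.sum_w_mul_single]
  have hA' : ∀ κ : Fin 2, (fun jj => β'.g t (Matrix.single κ jj (1 : ZMod 3))) = ∑ l, A κ l • b l := by
    intro κ; rw [hrows']; exact hA κ
  have hDch' : ∀ t', t' ∉ RD → ∀ m, β'.g t' (Matrix.vecMulVec (![-((![![1, 0], ![0, 1], ![1, 1], ![1, 2]] : Fin 4 → Fin 2 → ZMod 3) Dr 1), (![![1, 0], ![0, 1], ![1, 1], ![1, 2]] : Fin 4 → Fin 2 → ZMod 3) Dr 0] : Fin 2 → ZMod 3) (cD m)) = 0 := by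
    intro t' ht' m
    rw [hg, RowSubcomp.pairing_eq]
    exact hDch t' ht' m
  have hSch' : ∀ t', t' ∉ RS → ∀ m, β'.g t' (Matrix.vecMulVec (![-((![![1, 0], ![0, 1], ![1, 1], ![1, 2]] : Fin 4 → Fin 2 → ZMod 3) S' 1), (![![1, 0], ![0, 1], ![1, 1], ![1, 2]] : Fin 4 → Fin 2 → ZMod 3) S' 0] : Fin 2 → ZMod 3) (cS m)) = 0 := by
    intro t' ht' m
    rw [hg, RowSubcomp.pairing_eq]
    exact hSch t' ht' m
  exact ZKKIRow.single_shape β' b t A hA' Dr S' hDS RD RS cD cS htD htS hDch' hSch' hDdet hSnz r hSr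

/-- **The two single cells of a `(Z,K,K,I)` column have DIFFERENT null points** (output side): with the shape of `single_shape` from the other single's row
(`rep r₂`) and the own row `S₁` (row plane `RS` of 4 terms, cheap output data `cS`, own block with left null representative `rep r₁`), `r₁ ≠ r₂`. -/
theorem null_reps_ne [DecidableEq ι] (β : BilinComp (mulBilin (ZMod 3) 2 2 n) ι) (b : Fin 2 → (Fin n → ZMod 3)) (t : ι)
    (A : Matrix (Fin 2) (Fin 2) (ZMod 3)) (hA : ∀ κ : Fin 2, β.w t κ = ∑ l, A κ l • b l)
    (S₁ : Fin 4) (RS : Finset ι) (hR4 : RS.card = 4) (cS : Fin 2 → (Fin n → ZMod 3))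
    (hci : ∀ a : Fin 2 → ZMod 3, ∑ m, a m • cS m = 0 → ∀ m, a m = 0)
    (hSch : ∀ t', t' ∉ RS → ∀ m, ∑ i, cS m i * (Matrix.vecMul (![-((![![1, 0], ![0, 1], ![1, 1], ![1, 2]] : Fin 4 → Fin 2 → ZMod 3) S₁ 1), (![![1, 0], ![0, 1], ![1, 1], ![1, 2]] : Fin 4 → Fin 2 → ZMod 3) S₁ 0] : Fin 2 → ZMod 3) (β.w t')) i = 0)
    (ht : t ∈ RS) (Dr r₂ : Fin 4) (e : ZMod 3)
    (hshape : ∀ q l, A q l = e * (![![1, 0], ![0, 1], ![1, 1], ![1, 2]] : Fin 4 → Fin 2 → ZMod 3) Dr q * (![![1, 0], ![0, 1], ![1, 1], ![1, 2]] : Fin 4 → Fin 2 → ZMod 3) r₂ l)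
    (r₁ : Fin 4) (hS1r : Matrix.vecMul ((![![1, 0], ![0, 1], ![1, 1], ![1, 2]] : Fin 4 → Fin 2 → ZMod 3) r₁) (Matrix.of fun l m => b l ⬝ᵥ cS m) = 0) :
    r₁ ≠ r₂ := by
  classical
  obtain ⟨β', -, hg, hw⟩ := exists_transposeDual' β
  have hrows' : ∀ κ, (fun jj => β'.g t (Matrix.single κ jj (1 : ZMod 3))) = β.w t κ := by
    intro κ; funext jj; rw [hg, CheapSpans.sum_w_mul_single]
  have hA' : ∀ κ : Fin 2, (fun jj => β'.g t (Matrix.single κ jj (1 : ZMod 3))) = ∑ l, A κ l • b l := by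
    intro κ; rw [hrows']; exact hA κ
  have hSch' : ∀ t', t' ∉ RS → ∀ m, β'.g t' (Matrix.vecMulVec (![-((![![1, 0], ![0, 1], ![1, 1], ![1, 2]] : Fin 4 → Fin 2 → ZMod 3) S₁ 1), (![![1, 0], ![0, 1], ![1, 1], ![1, 2]] : Fin 4 → Fin 2 → ZMod 3) S₁ 0] : Fin 2 → ZMod 3) (cS m)) = 0 := by
    intro t' ht' m
    rw [hg, RowSubcomp.pairing_eq]
    exact hSch t' ht' m
  exact ZKKIRow.null_reps_ne β' b t A hA' S₁ RS hR4 cS hci hSch' ht Dr r₂ e hshape r₁ hS1r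

end ZKKICol

end Summit.MatrixMultiplication.OmegaCensus.SmallFormats
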